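/-
Copyright (c) 2026 the pub-hodgecm-mathlib formalisation cell (harness21).  Prover seat hodgecm-mathlib-K2Liu-p09 (g9), Track B «K2-LIT» ∕ hLiu418
#184♮, #42S BLOCK D row D-2, (σ-A) brick (b′) «the corner implementer letters» = (α′) §4 (road desk K2Liu-p25 (g3) WORDS #21, #24, #28, #34), 2026-09-05.
THEOREMS ONLY.
-/
import Summits.HodgeConjecture.HodgeConjecture.Theorems.K2LiuLocalCayleyMoverLeviImage         -- (α′) §1–§3: the bi-mover's Levi image (this seat)
import Summits.HodgeConjecture.HodgeConjecture.Theorems.K2LiuWitnessImplementerCayley         -- ★ (C2c): the frame composite `π(frameMp_{PD} j̃(p₁,p₂))` is a Cayley-type mover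
import Summits.HodgeConjecture.HodgeConjecture.Theorems.K2LiuLocalSWCornerActionWordsYStage    -- ★ p864439 (Y1) `blkC (matA (w₁·φ(w₂))) = 0` (+ ★ [A1-mat] p864192 ∕ p864250)
import Summits.HodgeConjecture.HodgeConjecture.Theorems.K2LiuLocalSWTensorAdaptedBlocks        -- ★ F5c-A: `matA_tensorEmbLoc`, `blk_reindex_kronecker`
import HarnessLib

/-!
# Crux `HLiu418`, #42S block D row D-2, (σ-A) brick (b′): THE CORNER IMPLEMENTER LETTERS `hB` ARE ∃-DISCHARGED AT THE IMPLEMENTER OF RECORD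
# `m = frameMp_{PD} j̃(p₁, p₂)` OVER CAYLEY-TYPE BLOCK MOVERS — in ★ [A1-ζ]'s `hB` binder bytes

Cell `hodgecm-mathlib`, crux item hLiu418 = `stmt-HodgeConjecture-24832`; squad K2 ∕ K2Liu; helper lane `--supports stmt-HodgeConjecture-24832 --as helper`,
count-neutral.  THEOREMS ONLY (no `def`, no `instance`, no `notation`, no named-fact hypothesis, no `sorry`).

WHY.  ★ [A1-ζ] `K2LiuLocalSWCornerActionWordsZeta.toRep_conj_tensorEmbLoc_eq_smul_leviOpPi` (F0P2-p07 (g2)) reads the Schrödinger-model action of a small Siegel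
element `p₀ ⊗ 1` of the tensor datum through ANY implementer `m` with the Levi letter `hB : π(m) · ι(p₀ ⊗ 1) · π(m)⁻¹ = transportSp 𝕋 (m(B))` BY VALUE.  In ★ [A1]
(p864240 ∕ p864439) the vector is read at the implementer of record `m = frameMp_{PD} j̃(p₁, p₂)` (★ (C2a) ∕ (M1)); ★ (C2c) `K2LiuWitnessImplementerCayley` proves
that `E′ = π(m)` is a MOVER (`E′ ℓ_Δ = ℓ_Y`, from the block movers `hp₁ hp₂`) with a CAYLEY letter (`E′ ι(w_Δ) E′⁻¹ = J_𝕋⁻¹ m(B′)`, from Cayley-type `hW₁ hW₂`);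
(α′) `K2LiuLocalCayleyMoverLeviImage.exists_conj_iotaD_eq_transportSp_levi` (this seat) turns these two letters into «`E′` conjugates EVERY Siegel-Levi element
into a standard Levi».  THIS FILE instantiates:
* `blkB_matA_tensorEmbLoc_of_blkB` — `B(p₀ ⊗ 1) = 0` for `B(p₀) = 0` (★ F5c-A `blk_reindex_kronecker`; the `C`-twin is ★ [A1-ζ] `blkC_matA_tensorEmbLoc_of_blkC`);
* **`exists_proj_frameMp_boxLoc_conj_iotaD_eq_levi`** — for every Siegel-LEVI `p` of the TENSOR group: `∃ B, E′ ι(p) E′⁻¹ = transportSp 𝕋 (m(B))`;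
* **`exists_hB_tensorEmbLoc`** — for every small Siegel-Levi `p₀` (`B(p₀) = 0 = C(p₀)`): `∃ B, π(m) · ι(p₀ ⊗ 1) · π(m)⁻¹ = transportSp 𝕋 (m(B))` in ★ [A1-ζ]'s `hB`
  BYTES (`𝕋`'s unit `isUnit_det_localGram_gramD … hT₀d`), at `m := frameMp_{PD} j̃(p₁, p₂)`;
* the three corner letters by name: **`exists_hB_frameConj_weylOne`**, **`exists_hB_frameConj_uMinus`** (★ B1b-2d `blocks_matA_frameConj_weylOne ∕ uMinus`:
  `B = 0 = C`) and **`exists_hB_flip_mul_frameConj_weylTwo`** (★ [A1-mat] `isSiegelDelta_flip_mul_frameConj_weylTwo` `B = 0`, ★ p864439 (Y1) `C = 0`).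
With these the END assembler `obtain`s every implementer letter of [A1] from the Cayley-type block data `(p₁, B₁, hW₁, hp₁; p₂, B₂, hW₂, hp₂)` — themselves
∃-supplied by ★ GR91 `exists_mover_conj_iotaD_weylDelta` + ★ `MpPsi.proj_surjective` (or by (α′) `exists_cayleyMover_levi_package`).
HONEST LABEL.  Count-neutral helper: `HC_CM` is proved only modulo the 7 printed citations (2 remaining named inputs: hLiu418 = `stmt-HodgeConjecture-24832`,
h413 = `stmt-HodgeConjecture-24833`) until rung 0 closes.

## References
* [Kudla1994] S. S. Kudla, Israel J. Math. 87 (1994), §3, Thm. 3.1.   * [MoeglinVignerasWaldspurger1987] LNM 1291 (1987), Chap. 2 II.1–II.2.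
* [HarrisKudlaSweet1996] M. Harris, S. Kudla, W. J. Sweet, J. AMS 9 (1996), §1 (1.11)–(1.12), (1.15)–(1.16).   * [Weil1964] A. Weil, Acta Math. 111 (1964), n° 5–6, 32, 34.
-/

set_option autoImplicit false
-- the mandated namespace repeats the single-problem summit's segment (`HodgeConjecture.HodgeConjecture`)
set_option linter.dupNamespace false

noncomputable section

open scoped Matrix Kronecker
open NumberField IsDedekindDomain Matrix
open Literature.RepresentationTheory.HeisenbergGroup Literature.RepresentationTheory.HeisenbergGroup.SymplecticMatrix
open Literature.NumberTheory.Automorphic Literature.NumberTheory.Automorphic.UnitaryGroup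
open Literature.NumberTheory.GelbartRogawski1991 Literature.NumberTheory.GelbartRogawski1991.GRConstruction
open Literature.NumberTheory.GelbartRogawski1991.AdaptedBlocks
open Literature.NumberTheory.GelbartRogawski1991.UnitaryDualPair
open Literature.NumberTheory.GelbartRogawski1991.UnitaryDualPair.LocalSplitting
open Literature.NumberTheory.GelbartRogawski1991.UnitaryDualPair.LocalSplitting.FrameTransport
open Literature.NumberTheory.GelbartRogawski1991.UnitaryDualPair.LocalSplitting.DoubledBlock
open Literature.NumberTheory.K2Lit.SiegelDoubled Literature.NumberTheory.K2Lit.LocalSiegelDoubled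
open Summit.HodgeConjecture.HodgeConjecture.Cruxes.HLiu418.K2LiuLocalSWSectionDefs
open Summit.HodgeConjecture.HodgeConjecture.Cruxes.HLiu418.K2LiuLocalSWTensorAdaptedBlocks
open Summit.HodgeConjecture.HodgeConjecture.Cruxes.HLiu418.K2LiuLocalSiegelIwasawa (antidiagonal_over_eq_map)
open Summit.HodgeConjecture.HodgeConjecture.Cruxes.HLiu418.K2LiuDoubledUTwoTwoBorelFrame (uMinus)
open Summit.HodgeConjecture.HodgeConjecture.Cruxes.HLiu418.K2LiuDoubledUTwoTwoWeylCocycle (weylOne weylTwo)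
open Summit.HodgeConjecture.HodgeConjecture.Cruxes.HLiu418.K2LiuDoubledUTwoTwoFrameTransport (toLocalFour)
open Summit.HodgeConjecture.HodgeConjecture.Cruxes.HLiu418.K2LiuDoubledUTwoTwoLetterTransport (blocks_matA_frameConj_weylOne blocks_matA_frameConj_uMinus)
open Summit.HodgeConjecture.HodgeConjecture.Cruxes.HLiu418.K2LiuLocalFourCornerFactorisation (isSiegelDelta_flip_mul_frameConj_weylTwo)
open Summit.HodgeConjecture.HodgeConjecture.Cruxes.HLiu418.K2LiuLocalSWCornerActionWordsYStage (blkC_matA_flip_mul_frameConj_weylTwo)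
open Summit.HodgeConjecture.HodgeConjecture.Cruxes.HLiu418.K2LiuWitnessImplementerCayley
open Summit.HodgeConjecture.HodgeConjecture.Cruxes.HLiu418.K2LiuLocalCayleyMoverLeviImage (exists_conj_iotaD_eq_transportSp_levi)

namespace Summit.HodgeConjecture.HodgeConjecture.Cruxes.HLiu418.K2LiuLocalSWCornerImplementerLetters

variable (L : Type) [Field L] [NumberField L] [IsCMField L]
variable {N M : ℕ} (e : Fin N × Fin M ≃ Fin 2)
  (dV : Fin N → L) (hdV : ∀ i, IsCMField.complexConj L (dV i) = dV i)
  (dW : Fin M → L) (hdW : ∀ i, IsCMField.complexConj L (dW i) = dW i)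
variable {M₂ M' : ℕ} (eW : Fin M × Fin M₂ ≃ Fin M') (e' : Fin N × Fin M' ≃ Fin (M₂ + M₂))
  (dV' : Fin M₂ → L) (hdV' : ∀ k, IsCMField.complexConj L (dV' k) = dV' k)
  (v : HeightOneSpectrum (𝓞 (Fp L)))

/-! ## §1 `B(p₀ ⊗ 1) = 0` for a small Levi element -/

/-- **`B(p₀ ⊗ 1) = 0`** for `B(p₀) = 0` (★ F5c-A `blk_reindex_kronecker`: `B ⊗ 1`; the `C`-twin is ★ [A1-ζ] `blkC_matA_tensorEmbLoc_of_blkC`). [cite: Kudla1994, §3] -/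
theorem blkB_matA_tensorEmbLoc_of_blkB (p₀ : UnitaryGroup.localPi L (IsCMField.complexConj L) (2 + 2) (hermD L e dV hdV dW hdW) v)
    (hB : blkB (matA (Fp L) L (IsCMField.complexConj L) v 2 p₀) = 0) :
    blkB (matA (Fp L) L (IsCMField.complexConj L) v (M₂ + M₂) (tensorEmbLoc L e dV hdV dW hdW eW e' dV' hdV' v p₀)) = 0 := by
  obtain ⟨-, hB', -, -⟩ := blk_reindex_kronecker (epsV e eW e') (matA (Fp L) L (IsCMField.complexConj L) v 2 p₀)
    (1 : Matrix (Fin M₂) (Fin M₂) (LocalRing L v))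
  rw [matA_tensorEmbLoc, hB', hB]
  ext i j
  simp [Matrix.reindex_apply]

/-! ## §2 The implementer of record `frameMp_{PD} j̃(p₁, p₂)` over Cayley-type block movers conjugates every Siegel-Levi element into a standard Levi -/

section FrameComposite

variable {σ : Equiv.Perm (Fin (M₂ + M₂))} {T₁ T₂ : Matrix (Fin M₂) (Fin M₂) (Fp L)}
  (P : GL (Fin (M₂ + M₂)) (Fp L)) (hPσ : (P : Matrix (Fin (M₂ + M₂)) (Fin (M₂ + M₂)) (Fp L)) = σ.toPEquiv.toMatrix)
  (hP : ((P : Matrix (Fin (M₂ + M₂)) (Fin (M₂ + M₂)) (Fp L)))ᵀ *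
      gramR L e' dV hdV (tensorFrame L dW eW dV') (tensorFrame_real L dW hdW eW dV' hdV') * (P : Matrix _ _ (Fp L)) =
    UnitaryGroup.finSum M₂ M₂ T₁ T₂)
  {PD : GL (Fin ((M₂ + M₂) + (M₂ + M₂))) (Fp L)} (hPD : PD = UnitaryGroup.reindexGL (e₂ (M₂ + M₂)) (UnitaryGroup.blockDiagGL (P, P)))
  (hT₁ : T₁.IsSymm) (hT₂ : T₂.IsSymm)
  (hT₀d : IsUnit (gramR L e' dV hdV (tensorFrame L dW eW dV') (tensorFrame_real L dW hdW eW dV' hdV')).det)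
  (hTv' : IsUnit (localGram (Fp L) ((M₂ + M₂) + (M₂ + M₂)) (gramD (Fp L) (M₂ + M₂) (UnitaryGroup.finSum M₂ M₂ T₁ T₂)) v).det)
  (hTv₁ : IsUnit (localGram (Fp L) (M₂ + M₂) (gramD (Fp L) M₂ T₁) v).det)
  (hTv₂ : IsUnit (localGram (Fp L) (M₂ + M₂) (gramD (Fp L) M₂ T₂) v).det)
  -- Cayley-type block movers (★ GR91 `exists_mover_conj_iotaD_weylDelta` + ★ `MpPsi.proj_surjective`)
  (p₁ : LocalMp (Fp L) (M₂ + M₂) (gramD (Fp L) M₂ T₁) v)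
  (hp₁ : (deltaLagrangian (Fp L) v M₂).map (toLin (Fp L) v (MpPsi.proj _ p₁)) = lagrangianY (Fp L) (M₂ + M₂) v)
  (B₁ : GL (Fin (M₂ + M₂)) (v.adicCompletion (Fp L)))
  (hW₁ : MpPsi.proj _ p₁ * iotaD (Fp L) L (IsCMField.complexConj L) (complexConj_imagUnit L) (imagUnit_ne_zero L)
      (imagUnit_mul_self L) v M₂ hT₁ rfl (weylDelta (Fp L) L (IsCMField.complexConj L) v M₂ (T₀ := T₁) rfl) * (MpPsi.proj _ p₁)⁻¹ =
    (transportSp (localGram (Fp L) (M₂ + M₂) (gramD (Fp L) M₂ T₁) v) hTv₁ (SymplecticGroup.symJ _ _))⁻¹ *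
      transportSp (localGram (Fp L) (M₂ + M₂) (gramD (Fp L) M₂ T₁) v) hTv₁ (levi B₁))
  (p₂ : LocalMp (Fp L) (M₂ + M₂) (gramD (Fp L) M₂ T₂) v)
  (hp₂ : (deltaLagrangian (Fp L) v M₂).map (toLin (Fp L) v (MpPsi.proj _ p₂)) = lagrangianY (Fp L) (M₂ + M₂) v)
  (B₂ : GL (Fin (M₂ + M₂)) (v.adicCompletion (Fp L)))
  (hW₂ : MpPsi.proj _ p₂ * iotaD (Fp L) L (IsCMField.complexConj L) (complexConj_imagUnit L) (imagUnit_ne_zero L)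
      (imagUnit_mul_self L) v M₂ hT₂ rfl (weylDelta (Fp L) L (IsCMField.complexConj L) v M₂ (T₀ := T₂) rfl) * (MpPsi.proj _ p₂)⁻¹ =
    (transportSp (localGram (Fp L) (M₂ + M₂) (gramD (Fp L) M₂ T₂) v) hTv₂ (SymplecticGroup.symJ _ _))⁻¹ *
      transportSp (localGram (Fp L) (M₂ + M₂) (gramD (Fp L) M₂ T₂) v) hTv₂ (levi B₂))

set_option maxHeartbeats 1600000 in -- MEASURED: 200000 RED (isDefEq∕whnf on the doubled `LocalSp`∕`LocalMp` letters), ★ (C2c)'s class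
include hPσ hT₁ hT₂ hTv' hTv₁ hTv₂ hW₁ hW₂ hp₁ hp₂ in
/-- **THE IMPLEMENTER OF RECORD CONJUGATES EVERY SIEGEL-LEVI ELEMENT OF THE TENSOR GROUP INTO A STANDARD LEVI**: with `E′ := π(frameMp_{PD} j̃(p₁, p₂))`
over Cayley-type block movers, for every `p ∈ M_Δ(L⁺_v)` of `U((𝕍 ⊗ V′)^𝔻)` (`B(p) = 0 = C(p)`): `∃ B, E′ · ι(p) · E′⁻¹ = transportSp 𝕋 (m(B))` — ★ (C2c)'s two
letters (`E′ ℓ_Δ = ℓ_Y`, `E′ ι(w_Δ) E′⁻¹ = J_𝕋⁻¹ m(B′)`) fed to (α′) `exists_conj_iotaD_eq_transportSp_levi`. [cite: Kudla1994, §3] [cite: MoeglinVignerasWaldspurger1987, Chap. 2 II.2] -/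
theorem exists_proj_frameMp_boxLoc_conj_iotaD_eq_levi
    {p : UnitaryGroup.localPi L (IsCMField.complexConj L) ((M₂ + M₂) + (M₂ + M₂))
      (hermD L e' dV hdV (tensorFrame L dW eW dV') (tensorFrame_real L dW hdW eW dV' hdV')) v}
    (hB : blkB (matA (Fp L) L (IsCMField.complexConj L) v (M₂ + M₂) p) = 0) (hC : blkC (matA (Fp L) L (IsCMField.complexConj L) v (M₂ + M₂) p) = 0) :
    ∃ B : GL (Fin ((M₂ + M₂) + (M₂ + M₂))) (v.adicCompletion (Fp L)),
      MpPsi.proj _ (frameMp (Fp L) v ((M₂ + M₂) + (M₂ + M₂)) PD (transpose_pd_mul_gramD_mul_pd (Fp L) (M₂ + M₂) P hP hPD)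
          (boxLoc (Fp L) v M₂ M₂ (T₁ := T₁) (T₂ := T₂) (p₁, p₂))) *
        iotaD (Fp L) L (IsCMField.complexConj L) (complexConj_imagUnit L) (imagUnit_ne_zero L) (imagUnit_mul_self L) v (M₂ + M₂)
          (gramR_isSymm L e' dV hdV (tensorFrame L dW eW dV') (tensorFrame_real L dW hdW eW dV' hdV'))
          (hermD_eq_map_gramD L e' dV hdV (tensorFrame L dW eW dV') (tensorFrame_real L dW hdW eW dV' hdV')) p *
        (MpPsi.proj _ (frameMp (Fp L) v ((M₂ + M₂) + (M₂ + M₂)) PD (transpose_pd_mul_gramD_mul_pd (Fp L) (M₂ + M₂) P hP hPD)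
          (boxLoc (Fp L) v M₂ M₂ (T₁ := T₁) (T₂ := T₂) (p₁, p₂))))⁻¹ =
      transportSp (localGram (Fp L) ((M₂ + M₂) + (M₂ + M₂))
          (gramD (Fp L) (M₂ + M₂) (gramR L e' dV hdV (tensorFrame L dW eW dV') (tensorFrame_real L dW hdW eW dV' hdV'))) v)
        (isUnit_det_localGram_gramD (Fp L) v (M₂ + M₂) hT₀d) (levi B) := by
  haveI : Algebra.IsQuadraticExtension (Fp L) L := IsCMField.isQuadraticExtension L
  obtain ⟨B', hW⟩ := exists_proj_frameMp_boxLoc_conj_iotaD_weylDelta L dV hdV dW hdW eW e' dV' hdV' v P hPσ hP hPD hT₁ hT₂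
    (isUnit_det_localGram_gramD (Fp L) v (M₂ + M₂) hT₀d) hTv' hTv₁ hTv₂ p₁ B₁ hW₁ p₂ B₂ hW₂
  exact exists_conj_iotaD_eq_transportSp_levi (Fp L) L (IsCMField.complexConj L) (complexConj_imagUnit L) (imagUnit_ne_zero L) (imagUnit_mul_self L) v
    (M₂ + M₂) (gramR_isSymm L e' dV hdV (tensorFrame L dW eW dV') (tensorFrame_real L dW hdW eW dV' hdV'))
    (hermD_eq_map_gramD L e' dV hdV (tensorFrame L dW eW dV') (tensorFrame_real L dW hdW eW dV' hdV'))
    (isUnit_det_localGram_gramD (Fp L) v (M₂ + M₂) hT₀d)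
    (MpPsi.proj _ (frameMp (Fp L) v ((M₂ + M₂) + (M₂ + M₂)) PD (transpose_pd_mul_gramD_mul_pd (Fp L) (M₂ + M₂) P hP hPD)
      (boxLoc (Fp L) v M₂ M₂ (T₁ := T₁) (T₂ := T₂) (p₁, p₂))))
    (map_deltaLagrangian_proj_frameMp_boxLoc L dV hdV dW hdW eW e' dV' hdV' v P hP hPD p₁ hp₁ p₂ hp₂) hW hB hC

set_option maxHeartbeats 1600000 in -- MEASURED: 200000 RED (isDefEq∕whnf on the doubled `LocalSp`∕`LocalMp` letters), ★ (C2c)'s class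
include hPσ hT₁ hT₂ hTv' hTv₁ hTv₂ hW₁ hW₂ hp₁ hp₂ in
/-- **★ [A1-ζ]'s LEVI LETTER `hB` ∃-DISCHARGED at `m := frameMp_{PD} j̃(p₁, p₂)`**: for every small Siegel-Levi `p₀ ∈ M_Δ` of `U(𝕍^𝔻)(L⁺_v)` (`B(p₀) = 0 = C(p₀)`),
`∃ B, π(m) · ι(p₀ ⊗ 1) · π(m)⁻¹ = transportSp 𝕋 (m(B))` — the binder bytes of ★ `K2LiuLocalSWCornerActionWordsZeta.toRep_conj_tensorEmbLoc_eq_smul_leviOpPi`.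
[cite: Kudla1994, §3, Thm. 3.1] [cite: HarrisKudlaSweet1996, §1 (1.15)–(1.16)] -/
theorem exists_hB_tensorEmbLoc (p₀ : UnitaryGroup.localPi L (IsCMField.complexConj L) (2 + 2) (hermD L e dV hdV dW hdW) v)
    (hB : blkB (matA (Fp L) L (IsCMField.complexConj L) v 2 p₀) = 0) (hC : blkC (matA (Fp L) L (IsCMField.complexConj L) v 2 p₀) = 0) :
    ∃ B : GL (Fin ((M₂ + M₂) + (M₂ + M₂))) (v.adicCompletion (Fp L)),
      MpPsi.proj _ (frameMp (Fp L) v ((M₂ + M₂) + (M₂ + M₂)) PD (transpose_pd_mul_gramD_mul_pd (Fp L) (M₂ + M₂) P hP hPD)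
          (boxLoc (Fp L) v M₂ M₂ (T₁ := T₁) (T₂ := T₂) (p₁, p₂))) *
        iotaD (Fp L) L (IsCMField.complexConj L) (complexConj_imagUnit L) (imagUnit_ne_zero L) (imagUnit_mul_self L) v (M₂ + M₂)
          (gramR_isSymm L e' dV hdV (tensorFrame L dW eW dV') (tensorFrame_real L dW hdW eW dV' hdV'))
          (hermD_eq_map_gramD L e' dV hdV (tensorFrame L dW eW dV') (tensorFrame_real L dW hdW eW dV' hdV'))
          (tensorEmbLoc L e dV hdV dW hdW eW e' dV' hdV' v p₀) *
        (MpPsi.proj _ (frameMp (Fp L) v ((M₂ + M₂) + (M₂ + M₂)) PD (transpose_pd_mul_gramD_mul_pd (Fp L) (M₂ + M₂) P hP hPD)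
          (boxLoc (Fp L) v M₂ M₂ (T₁ := T₁) (T₂ := T₂) (p₁, p₂))))⁻¹ =
      transportSp (localGram (Fp L) ((M₂ + M₂) + (M₂ + M₂))
          (gramD (Fp L) (M₂ + M₂) (gramR L e' dV hdV (tensorFrame L dW eW dV') (tensorFrame_real L dW hdW eW dV' hdV'))) v)
        (isUnit_det_localGram_gramD (Fp L) v (M₂ + M₂) hT₀d) (levi B) := by
  have hB' := blkB_matA_tensorEmbLoc_of_blkB L e dV hdV dW hdW eW e' dV' hdV' v p₀ hB
  have hC' : blkC (matA (Fp L) L (IsCMField.complexConj L) v (M₂ + M₂) (tensorEmbLoc L e dV hdV dW hdW eW e' dV' hdV' v p₀)) = 0 := by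
    rw [(blk_matA_tensorEmbLoc L e dV hdV dW hdW eW e' dV' hdV' v p₀).2, hC]
    ext i j
    simp [Matrix.reindex_apply]
  exact exists_proj_frameMp_boxLoc_conj_iotaD_eq_levi L dV hdV dW hdW eW e' dV' hdV' v P hPσ hP hPD hT₁ hT₂ hT₀d hTv' hTv₁ hTv₂ p₁ hp₁ B₁ hW₁ p₂ hp₂ B₂ hW₂
    hB' hC'

/-! ## §3 The three corner letters by name -/

variable (D Dinv : Matrix (Fin 2) (Fin 2) (Fp L)) (hDD : D * Dinv = 1) (Q : GL (Fin (2 + 2)) (Fp L))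
  (hQm : (Q : Matrix (Fin (2 + 2)) (Fin (2 + 2)) (Fp L)) = Matrix.reindex (e₂ 2) (e₂ 2) (Matrix.fromBlocks 1 D 1 (-D)))
  (hQ : (Q : Matrix (Fin (2 + 2)) (Fin (2 + 2)) (Fp L))ᵀ * gramD (Fp L) 2 (gramR L e dV hdV dW hdW) * (Q : Matrix (Fin (2 + 2)) (Fin (2 + 2)) (Fp L)) =
    (StdForm.antidiagonal (2 + 2)).over (Fp L))

set_option maxHeartbeats 1600000 in -- MEASURED: 200000 RED (isDefEq∕whnf on the doubled `LocalSp`∕`LocalMp` letters), ★ (C2c)'s class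
include hPσ hT₁ hT₂ hTv' hTv₁ hTv₂ hW₁ hW₂ hp₁ hp₂ hDD hQm in
/-- **`hB` for the ζ-stage Weyl letter `φ(w₁′) ⊗ 1`** (★ B1b-2d `blocks_matA_frameConj_weylOne`: `B = 0 = C`). [cite: Casselman1980, §3] [cite: Kudla1994, §3] -/
theorem exists_hB_frameConj_weylOne :
    ∃ B : GL (Fin ((M₂ + M₂) + (M₂ + M₂))) (v.adicCompletion (Fp L)),
      MpPsi.proj _ (frameMp (Fp L) v ((M₂ + M₂) + (M₂ + M₂)) PD (transpose_pd_mul_gramD_mul_pd (Fp L) (M₂ + M₂) P hP hPD)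
          (boxLoc (Fp L) v M₂ M₂ (T₁ := T₁) (T₂ := T₂) (p₁, p₂))) *
        iotaD (Fp L) L (IsCMField.complexConj L) (complexConj_imagUnit L) (imagUnit_ne_zero L) (imagUnit_mul_self L) v (M₂ + M₂)
          (gramR_isSymm L e' dV hdV (tensorFrame L dW eW dV') (tensorFrame_real L dW hdW eW dV' hdV'))
          (hermD_eq_map_gramD L e' dV hdV (tensorFrame L dW eW dV') (tensorFrame_real L dW hdW eW dV' hdV'))
          (tensorEmbLoc L e dV hdV dW hdW eW e' dV' hdV' v
            (FrameTransport.frameConj (Fp L) L (IsCMField.complexConj L) v (2 + 2) (hermD_eq_map_gramD L e dV hdV dW hdW)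
              (antidiagonal_over_eq_map (Fp L) L 2) Q hQ
              (toLocalFour (Fp L) L (IsCMField.complexConj L) v
                (weylOne (UnitaryGroup.LocalRing L v) (UnitaryGroup.conjLocal L (IsCMField.complexConj L) v))))) *
        (MpPsi.proj _ (frameMp (Fp L) v ((M₂ + M₂) + (M₂ + M₂)) PD (transpose_pd_mul_gramD_mul_pd (Fp L) (M₂ + M₂) P hP hPD)
          (boxLoc (Fp L) v M₂ M₂ (T₁ := T₁) (T₂ := T₂) (p₁, p₂))))⁻¹ =
      transportSp (localGram (Fp L) ((M₂ + M₂) + (M₂ + M₂))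
          (gramD (Fp L) (M₂ + M₂) (gramR L e' dV hdV (tensorFrame L dW eW dV') (tensorFrame_real L dW hdW eW dV' hdV'))) v)
        (isUnit_det_localGram_gramD (Fp L) v (M₂ + M₂) hT₀d) (levi B) := by
  obtain ⟨-, hB, hC⟩ := blocks_matA_frameConj_weylOne (Fp L) L (IsCMField.complexConj L) v (hermD_eq_map_gramD L e dV hdV dW hdW) D Dinv hDD Q hQm hQ
  exact exists_hB_tensorEmbLoc L e dV hdV dW hdW eW e' dV' hdV' v P hPσ hP hPD hT₁ hT₂ hT₀d hTv' hTv₁ hTv₂ p₁ hp₁ B₁ hW₁ p₂ hp₂ B₂ hW₂ _ hB hC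

set_option maxHeartbeats 1600000 in -- MEASURED: 200000 RED (isDefEq∕whnf on the doubled `LocalSp`∕`LocalMp` letters), ★ (C2c)'s class
include hPσ hT₁ hT₂ hTv' hTv₁ hTv₂ hW₁ hW₂ hp₁ hp₂ hDD hQm in
/-- **`hB` for the ζ-stage root letter `φ(u⁻(z)) ⊗ 1`**, `z ∈ L_v` (★ B1b-2d `blocks_matA_frameConj_uMinus`: `B = 0 = C`; ★ [A1-ζ] reads its scalar as `1`).
[cite: Rogawski1990, §1.9] [cite: Kudla1994, §3] -/
theorem exists_hB_frameConj_uMinus (z : UnitaryGroup.LocalRing L v) :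
    ∃ B : GL (Fin ((M₂ + M₂) + (M₂ + M₂))) (v.adicCompletion (Fp L)),
      MpPsi.proj _ (frameMp (Fp L) v ((M₂ + M₂) + (M₂ + M₂)) PD (transpose_pd_mul_gramD_mul_pd (Fp L) (M₂ + M₂) P hP hPD)
          (boxLoc (Fp L) v M₂ M₂ (T₁ := T₁) (T₂ := T₂) (p₁, p₂))) *
        iotaD (Fp L) L (IsCMField.complexConj L) (complexConj_imagUnit L) (imagUnit_ne_zero L) (imagUnit_mul_self L) v (M₂ + M₂)
          (gramR_isSymm L e' dV hdV (tensorFrame L dW eW dV') (tensorFrame_real L dW hdW eW dV' hdV'))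
          (hermD_eq_map_gramD L e' dV hdV (tensorFrame L dW eW dV') (tensorFrame_real L dW hdW eW dV' hdV'))
          (tensorEmbLoc L e dV hdV dW hdW eW e' dV' hdV' v
            (FrameTransport.frameConj (Fp L) L (IsCMField.complexConj L) v (2 + 2) (hermD_eq_map_gramD L e dV hdV dW hdW)
              (antidiagonal_over_eq_map (Fp L) L 2) Q hQ
              (toLocalFour (Fp L) L (IsCMField.complexConj L) v
                (uMinus (UnitaryGroup.LocalRing L v) (UnitaryGroup.conjLocal L (IsCMField.complexConj L) v)
                  (UnitaryGroup.conjLocal_conjLocal (IsCMField.complexConj L) v (complexConj_imagUnit L) (imagUnit_ne_zero L)) z)))) *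
        (MpPsi.proj _ (frameMp (Fp L) v ((M₂ + M₂) + (M₂ + M₂)) PD (transpose_pd_mul_gramD_mul_pd (Fp L) (M₂ + M₂) P hP hPD)
          (boxLoc (Fp L) v M₂ M₂ (T₁ := T₁) (T₂ := T₂) (p₁, p₂))))⁻¹ =
      transportSp (localGram (Fp L) ((M₂ + M₂) + (M₂ + M₂))
          (gramD (Fp L) (M₂ + M₂) (gramR L e' dV hdV (tensorFrame L dW eW dV') (tensorFrame_real L dW hdW eW dV' hdV'))) v)
        (isUnit_det_localGram_gramD (Fp L) v (M₂ + M₂) hT₀d) (levi B) := by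
  haveI : Algebra.IsQuadraticExtension (Fp L) L := IsCMField.isQuadraticExtension L
  obtain ⟨-, hB, hC⟩ := blocks_matA_frameConj_uMinus (Fp L) L (IsCMField.complexConj L) (complexConj_imagUnit L) (imagUnit_ne_zero L) v
    (hermD_eq_map_gramD L e dV hdV dW hdW) D Dinv hDD Q hQm hQ z
  exact exists_hB_tensorEmbLoc L e dV hdV dW hdW eW e' dV' hdV' v P hPσ hP hPD hT₁ hT₂ hT₀d hTv' hTv₁ hTv₂ p₁ hp₁ B₁ hW₁ p₂ hp₂ B₂ hW₂ _ hB hC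

variable {d₁ d₂ d₁' d₂' : Fp L} (hDa : D = !![0, d₁; d₂, 0]) (hDia : Dinv = !![0, d₁'; d₂', 0])
  {w₁ : UnitaryGroup.localPi L (IsCMField.complexConj L) (2 + 2) (hermD L e dV hdV dW hdW) v}
  (hw₁ : adapt (matA (Fp L) L (IsCMField.complexConj L) v 2 w₁) =
    Matrix.fromBlocks (1 - Matrix.single 1 1 1) (Matrix.single 1 1 1) (Matrix.single 1 1 1) (1 - Matrix.single 1 1 1))

set_option maxHeartbeats 1600000 in -- MEASURED: 200000 RED (isDefEq∕whnf on the doubled `LocalSp`∕`LocalMp` letters), ★ (C2c)'s class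
include hPσ hT₁ hT₂ hTv' hTv₁ hTv₂ hW₁ hW₂ hp₁ hp₂ hDD hQm hDa hDia hw₁ in
/-- **`hB` for the y-stage Levi factor `(w₁ · φ(w₂)) ⊗ 1`** (the vector's Levi letter in ★ p864439 (Y4)'s right-hand side; ★ [A1-mat] `isSiegelDelta_flip_mul_frameConj_weylTwo`:
`B = 0`, ★ p864439 (Y1): `C = 0`; scalar key ★ `detDelta_flip_mul_frameConj_weylTwo`). [cite: HarrisKudlaSweet1996, §1 (1.12), (1.15)] [cite: Kudla1994, §3] -/
theorem exists_hB_flip_mul_frameConj_weylTwo :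
    ∃ B : GL (Fin ((M₂ + M₂) + (M₂ + M₂))) (v.adicCompletion (Fp L)),
      MpPsi.proj _ (frameMp (Fp L) v ((M₂ + M₂) + (M₂ + M₂)) PD (transpose_pd_mul_gramD_mul_pd (Fp L) (M₂ + M₂) P hP hPD)
          (boxLoc (Fp L) v M₂ M₂ (T₁ := T₁) (T₂ := T₂) (p₁, p₂))) *
        iotaD (Fp L) L (IsCMField.complexConj L) (complexConj_imagUnit L) (imagUnit_ne_zero L) (imagUnit_mul_self L) v (M₂ + M₂)
          (gramR_isSymm L e' dV hdV (tensorFrame L dW eW dV') (tensorFrame_real L dW hdW eW dV' hdV'))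
          (hermD_eq_map_gramD L e' dV hdV (tensorFrame L dW eW dV') (tensorFrame_real L dW hdW eW dV' hdV'))
          (tensorEmbLoc L e dV hdV dW hdW eW e' dV' hdV' v
            (w₁ * FrameTransport.frameConj (Fp L) L (IsCMField.complexConj L) v (2 + 2) (hermD_eq_map_gramD L e dV hdV dW hdW)
              (antidiagonal_over_eq_map (Fp L) L 2) Q hQ
              (toLocalFour (Fp L) L (IsCMField.complexConj L) v
                (weylTwo (UnitaryGroup.LocalRing L v) (UnitaryGroup.conjLocal L (IsCMField.complexConj L) v))))) *
        (MpPsi.proj _ (frameMp (Fp L) v ((M₂ + M₂) + (M₂ + M₂)) PD (transpose_pd_mul_gramD_mul_pd (Fp L) (M₂ + M₂) P hP hPD)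
          (boxLoc (Fp L) v M₂ M₂ (T₁ := T₁) (T₂ := T₂) (p₁, p₂))))⁻¹ =
      transportSp (localGram (Fp L) ((M₂ + M₂) + (M₂ + M₂))
          (gramD (Fp L) (M₂ + M₂) (gramR L e' dV hdV (tensorFrame L dW eW dV') (tensorFrame_real L dW hdW eW dV' hdV'))) v)
        (isUnit_det_localGram_gramD (Fp L) v (M₂ + M₂) hT₀d) (levi B) := by
  haveI : Algebra.IsQuadraticExtension (Fp L) L := IsCMField.isQuadraticExtension L
  have hB := (isSiegelDelta_flip_mul_frameConj_weylTwo (Fp L) L (IsCMField.complexConj L) (complexConj_imagUnit L) (imagUnit_ne_zero L)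
    (imagUnit_mul_self L) v (gramR_isSymm L e dV hdV dW hdW) (hermD_eq_map_gramD L e dV hdV dW hdW) D Dinv hDD Q hQm hQ hDa hDia w₁
    (hw₁.trans K2LiuLocalSWCornerActionWordsYStage.fromBlocks_one_sub_single_one)).2
  have hC := blkC_matA_flip_mul_frameConj_weylTwo L e dV hdV dW hdW v D Dinv hDD Q hQm hQ hDa hDia hw₁
  exact exists_hB_tensorEmbLoc L e dV hdV dW hdW eW e' dV' hdV' v P hPσ hP hPD hT₁ hT₂ hT₀d hTv' hTv₁ hTv₂ p₁ hp₁ B₁ hW₁ p₂ hp₂ B₂ hW₂ _ hB hC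

end FrameComposite

end Summit.HodgeConjecture.HodgeConjecture.Cruxes.HLiu418.K2LiuLocalSWCornerImplementerLetters

end
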